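import Mathlib
import HarnessLib.Audit
import Summits.PneNP.PneNP.Theorems.PstarSharedMemberSquare
import Summits.PneNP.PneNP.Theorems.PstarClamp

/-!
# The square of a member whose literal has several siblings: the `hσonly` restriction removed (ROUND-24, O1; memo g29 §83)

FRONTIER range-avoidance ladder, rung F-N3, ROUND 24 (cell `pnp-ideate`, prover-2 memo `g29/O1-SIBLINGS-g29.md` §83; census node
`PstarLocalGateBudgetAssembly.LocalMenuCriterionBoundGateBudget`; restricted-model proof complexity — nothing here bears on `P` versus `NP`).

`PstarSharedMemberSquare` / `PstarSharedMemberKill` (g27 §74) treat a member `e = (σ, p)` of `K` whose literal `σ` is shared with EXACTLY ONE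
sibling `o = (σ, q)` in `K ∪ G₁` (hypothesis `Setup.hσonly`); g28 §80.4 lists the member type «`σ` shared with more than one sibling inside `K ∪ F₁`»
as not covered kernel-side.  This file removes the restriction: `(K; Γ₁, Γ₂)` a candidate certificate (`G₁` disjoint from `K`), `e ∈ K` with AND
pair `{σ, p}`, `p` PRIVATE, and an arbitrary finite set `S ⊆ K ∪ G₁` of SIBLINGS `o ≠ e`, each with AND pair `{σ, q o}` and `q o` private to `o`,
such that every output of `K ∪ G₁` through `σ` is `e` or a sibling (`S = ∅`, one sibling, a sibling fold in `G₁`, three outputs through `σ`, … all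
allowed); `σ, p, q o` no XOR variables of `K`, not in `C₁`; no monomial of `Γ₂` duplicates `{σ, p}` or `{σ, q o}`.
`Ā = Sol(K ∖ e) ∩ {Γ₁ = b₁}` (`InSliceBut`), `A = Ā ∩ Sol(e)` (`InSlice`), idle set `A₁ = A ∩ {x_σ = 0}` (the whole `σ`-block off).

* normalisation `p, q o := 0` (all `o ∈ S`) in one step by `PstarClamp.clamp`;
* moves: `sliceBut_update_p` (always), `sliceBut_update_q` / `inSlice_update_q` (when `x_σ = 0`), `sliceBut_update_sigma` (when every
  `x_{q o} = 0`), `inSlice_clamp` (normalising inside `A₁`);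
* `slope_p_zero`, `slope_q_zero` (on `A₁`), `slope_sigma_zero` (on `A ∩ {x_p = 0, x_{q o} = 0 ∀ o}`) — (T3) kills the slopes
  `L_v = [v ∈ C₂] + starSum(v)` of `Γ₂` in the free directions;
* `not_thawed_p`, `not_thawed_q`, `not_thawed_sigma` — a gate partner `u` of `p`, `q o` or `σ` (off the block) thawed in `A₁` is contradictory;
* `of_setup` — g27's one-sibling `PstarSharedMemberSquare.Setup` is the instance `S = {o}`.

The kill (`Γ₂ ≠ b₂` on all of `Ā`, (M0) fails at `e`) is the companion file `PstarMultiSiblingKill`.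
-/

set_option linter.dupNamespace false -- `Summit.PneNP.PneNP.…`: summit = sub-problem name (D-0017 single-conjunct layout)

open Finset Literature.Computability.Complexity
open Summit.PneNP.PneNP.Theorems.PstarFibrePolys (bit bit_injective)
open Summit.PneNP.PneNP.Theorems.PstarSALevel (varSet)
open Summit.PneNP.PneNP.Theorems.PstarGapPeeling (eval_pure eval_update_of_not_mem)
open Summit.PneNP.PneNP.Theorems.PstarGapOneAll (gval)
open Summit.PneNP.PneNP.Theorems.PstarGConstraint (bit_gval)
open Summit.PneNP.PneNP.Theorems.PstarMenuLocality (starSum bit_gval_update bit_gval_flip starSum_update_partner)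
open Summit.PneNP.PneNP.Theorems.PstarLiteralPinning (Through InSlice)
open Summit.PneNP.PneNP.Theorems.PstarDirtyMemberSquare (InSliceBut inSlice_iff starSum_update_of_unpaired)
open Summit.PneNP.PneNP.Theorems.PstarClamp (clamp clamp_of_mem clamp_of_not_mem clamp_empty clamp_insert clamp_false_of clamp_update_comm
  starSum_clamp_of_unpaired starSum_eq_zero_of_partners)

namespace Summit.PneNP.PneNP.Theorems.PstarMultiSiblingSquare

variable {n m : ℕ} {I : LocalMap 4 n m}

/-- The AND term of an output with pair `{a, b}` (either orientation). -/
private theorem term_eq {j : Fin m} {a b : Fin n} (h : (I.vars j 2 = a ∧ I.vars j 3 = b) ∨ (I.vars j 2 = b ∧ I.vars j 3 = a))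
    (z : Fin n → Bool) : (z (I.vars j 2) && z (I.vars j 3)) = (z a && z b) := by
  rcases h with ⟨h2, h3⟩ | ⟨h2, h3⟩
  · rw [h2, h3]
  · rw [h2, h3, Bool.and_comm]

/-- A variable off all four slots of an output is not one of its variables. -/
private theorem not_mem_varSet {j : Fin m} {v : Fin n} (h0 : I.vars j 0 ≠ v) (h1 : I.vars j 1 ≠ v) (h23 : ¬ Through I v j) :
    v ∉ varSet I j := by
  intro hmem
  unfold PstarSALevel.varSet at hmem
  obtain ⟨s, -, hs⟩ := mem_image.1 hmem
  fin_cases s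
  · exact h0 hs
  · exact h1 hs
  · exact h23 (Or.inl hs)
  · exact h23 (Or.inr hs)

/-! ## The hypotheses -/

/-- **The setting** (`Setup I K w₁ w₂ e σ p S q`): pure instance; `e ∈ K` with AND pair `{σ, p}`, `p` private to `e` (within `K ∪ G₁`); a set
`S ⊆ K ∪ G₁` of SIBLINGS, `e ∉ S`, sibling `o` with AND pair `{σ, q o}` and `q o` private to `o`; EVERY output of `K ∪ G₁` through `σ` is `e` or
a sibling (no bound on their number); `σ, p, q o ∉ C₁` and off the XOR slots of `K`; `G₁` disjoint from `K`; no monomial of `Γ₂` with pair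
`{σ, p}` or `{σ, q o}`. -/
structure Setup (I : LocalMap 4 n m) (K : Finset (Fin m)) (w₁ w₂ : Finset (Fin n) × Finset (Fin m) × Bool) (e : Fin m) (σ p : Fin n)
    (S : Finset (Fin m)) (q : Fin m → Fin n) : Prop where
  pure : I.IsPure xorAndPred
  he : e ∈ K
  hS : S ⊆ K ∪ w₁.2.1
  heS : e ∉ S
  hKG : Disjoint K w₁.2.1
  hse : (I.vars e 2 = σ ∧ I.vars e 3 = p) ∨ (I.vars e 2 = p ∧ I.vars e 3 = σ)
  hso : ∀ o ∈ S, (I.vars o 2 = σ ∧ I.vars o 3 = q o) ∨ (I.vars o 2 = q o ∧ I.vars o 3 = σ)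
  hσonly : ∀ j ∈ K ∪ w₁.2.1, Through I σ j → j = e ∨ j ∈ S
  hppriv : ∀ j ∈ K ∪ w₁.2.1, j ≠ e → ¬ Through I p j
  hqpriv : ∀ o ∈ S, ∀ j ∈ K ∪ w₁.2.1, j ≠ o → ¬ Through I (q o) j
  hC₁ : σ ∉ w₁.1 ∧ p ∉ w₁.1 ∧ ∀ o ∈ S, q o ∉ w₁.1
  hX : ∀ j ∈ K, I.vars j 0 ≠ σ ∧ I.vars j 1 ≠ σ ∧ I.vars j 0 ≠ p ∧ I.vars j 1 ≠ p ∧ ∀ o ∈ S, I.vars j 0 ≠ q o ∧ I.vars j 1 ≠ q o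
  hG₂ : ∀ g ∈ w₂.2.1, ¬ ((I.vars g 2 = σ ∧ I.vars g 3 = p) ∨ (I.vars g 2 = p ∧ I.vars g 3 = σ)) ∧
    ∀ o ∈ S, ¬ ((I.vars g 2 = σ ∧ I.vars g 3 = q o) ∨ (I.vars g 2 = q o ∧ I.vars g 3 = σ))

variable {y : Fin m → Bool} {K : Finset (Fin m)} {w₁ w₂ : Finset (Fin n) × Finset (Fin m) × Bool} {e : Fin m} {σ p : Fin n}
  {S : Finset (Fin m)} {q : Fin m → Fin n}

/-- **g27's one-sibling setting is the instance `S = {o}`** of this one. -/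
theorem of_setup {o : Fin m} {q₀ : Fin n} (H : PstarSharedMemberSquare.Setup I K w₁ w₂ e o σ p q₀) :
    Setup I K w₁ w₂ e σ p {o} (fun _ => q₀) where
  pure := H.pure
  he := H.he
  hS := singleton_subset_iff.2 H.ho
  heS := fun h => H.hoe (mem_singleton.1 h).symm
  hKG := H.hKG
  hse := H.hse
  hso := fun o' ho' => by rw [mem_singleton.1 ho']; exact H.hso
  hσonly := fun j hj hth => (H.hσonly j hj hth).imp_right fun h => mem_singleton.2 h
  hppriv := H.hppriv
  hqpriv := fun o' ho' j hj hne => H.hqpriv j hj (by rw [mem_singleton.1 ho'] at hne; exact hne)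
  hC₁ := ⟨H.hC₁.1, H.hC₁.2.1, fun _ _ => H.hC₁.2.2⟩
  hX := fun j hj => ⟨(H.hX j hj).1, (H.hX j hj).2.1, (H.hX j hj).2.2.1, (H.hX j hj).2.2.2.1, fun _ _ =>
    ⟨(H.hX j hj).2.2.2.2.1, (H.hX j hj).2.2.2.2.2⟩⟩
  hG₂ := fun g hg => ⟨(H.hG₂ g hg).1, fun _ _ => (H.hG₂ g hg).2⟩

section Main

/-! ### Distinctness -/

/-- `σ ≠ p`. -/
theorem sigma_ne_p (H : Setup I K w₁ w₂ e σ p S q) : σ ≠ p := by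
  have h1 : I.vars e 2 ≠ I.vars e 3 := fun h => absurd (H.pure.2 e h) (by decide)
  rcases H.hse with ⟨a, b⟩ | ⟨a, b⟩
  · rw [← a, ← b]; exact h1
  · rw [← a, ← b]; exact h1.symm

/-- `σ ≠ q o` for a sibling `o`. -/
theorem sigma_ne_q (H : Setup I K w₁ w₂ e σ p S q) {o : Fin m} (ho : o ∈ S) : σ ≠ q o := by
  have h2 : I.vars o 2 ≠ I.vars o 3 := fun h => absurd (H.pure.2 o h) (by decide)
  rcases H.hso o ho with ⟨a, b⟩ | ⟨a, b⟩
  · rw [← a, ← b]; exact h2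
  · rw [← a, ← b]; exact h2.symm

/-- `p ≠ q o` for a sibling `o` (privacy of `p`). -/
theorem p_ne_q (H : Setup I K w₁ w₂ e σ p S q) {o : Fin m} (ho : o ∈ S) : p ≠ q o := by
  intro hpq
  refine H.hppriv o (H.hS ho) (fun h => H.heS (h ▸ ho)) ?_
  rcases H.hso o ho with ⟨_, b⟩ | ⟨a, _⟩
  · exact Or.inr (b.trans hpq.symm)
  · exact Or.inl (a.trans hpq.symm)

/-- `p` is not a sibling private. -/
theorem p_not_mem_image (H : Setup I K w₁ w₂ e σ p S q) : p ∉ S.image q := fun h => by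
  obtain ⟨o, ho, hoq⟩ := mem_image.1 h
  exact p_ne_q H ho hoq.symm

/-- `σ` is off the normalisation set `{p} ∪ q(S)`. -/
theorem sigma_not_mem_norm (H : Setup I K w₁ w₂ e σ p S q) : σ ∉ insert p (S.image q) := fun h => by
  rcases mem_insert.1 h with h | h
  · exact sigma_ne_p H h
  · obtain ⟨o, ho, hoq⟩ := mem_image.1 h
    exact sigma_ne_q H ho hoq.symm

/-! ### Values of `e` and of the siblings -/

/-- The value of `e`: XOR part plus `x_σ x_p`. -/
theorem eval_e (H : Setup I K w₁ w₂ e σ p S q) (z : Fin n → Bool) : I.eval z e = xor (xor (z (I.vars e 0)) (z (I.vars e 1))) (z σ && z p) := by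
  rw [eval_pure I H.pure, term_eq H.hse]

/-- The value of a sibling `o`: XOR part plus `x_σ x_{q o}`. -/
theorem eval_sib (H : Setup I K w₁ w₂ e σ p S q) {o : Fin m} (ho : o ∈ S) (z : Fin n → Bool) :
    I.eval z o = xor (xor (z (I.vars o 0)) (z (I.vars o 1))) (z σ && z (q o)) := by
  rw [eval_pure I H.pure, term_eq (H.hso o ho)]

/-! ### Moves inside `Ā` -/

/-- Updating the private `p` stays in `Ā`. -/
theorem sliceBut_update_p (H : Setup I K w₁ w₂ e σ p S q) {z : Fin n → Bool} (hz : InSliceBut I y K e w₁ z) (b : Bool) : InSliceBut I y K e w₁ (Function.update z p b) := by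
  have heG : e ∉ w₁.2.1 := fun h => disjoint_left.1 H.hKG H.he h
  refine ⟨fun j hj hje => ?_, ?_⟩
  · rw [eval_update_of_not_mem I j z (not_mem_varSet (H.hX j hj).2.2.1 (H.hX j hj).2.2.2.1 (H.hppriv j (mem_union_left _ hj) hje)) b]
    exact hz.1 j hj hje
  · apply bit_injective
    rw [bit_gval_update I H.pure, if_neg H.hC₁.2.1, zero_add, hz.2]
    have : starSum I w₁.2.1 p z = 0 := by
      unfold PstarMenuLocality.starSum
      refine sum_eq_zero fun g hg => ?_
      have hge : g ≠ e := fun h => heG (h ▸ hg)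
      have := H.hppriv g (mem_union_right _ hg) hge
      rw [if_neg (fun h => this (Or.inl h)), if_neg (fun h => this (Or.inr h)), add_zero]
    rw [this, mul_zero, add_zero]

/-- With `x_σ = 0`, the partner sum of a sibling private `q o` over `G₁` vanishes (only `o` passes through `q o`, its partner is `σ`). -/
theorem starSum_q_eq_zero (H : Setup I K w₁ w₂ e σ p S q) {o : Fin m} (ho : o ∈ S) {z : Fin n → Bool} (hzσ : z σ = false) : starSum I w₁.2.1 (q o) z = 0 := by
  have hσq := sigma_ne_q H ho
  refine starSum_eq_zero_of_partners z fun g hg => ⟨fun h2 => ?_, fun h3 => ?_⟩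
  · by_cases hgo : g = o
    · subst hgo
      rcases H.hso g ho with ⟨a, _⟩ | ⟨_, b⟩
      · exact absurd (a.symm.trans h2) hσq
      · rw [b]; exact hzσ
    · exact absurd (Or.inl h2) (H.hqpriv o ho g (mem_union_right _ hg) hgo)
  · by_cases hgo : g = o
    · subst hgo
      rcases H.hso g ho with ⟨a, _⟩ | ⟨_, b⟩
      · rw [a]; exact hzσ
      · exact absurd (b.symm.trans h3) hσq
    · exact absurd (Or.inr h3) (H.hqpriv o ho g (mem_union_right _ hg) hgo)

/-- With `x_σ = 0`, updating a sibling's private `q o` keeps every output of `K` and the reader `Γ₁`. -/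
theorem sliceBut_update_q (H : Setup I K w₁ w₂ e σ p S q) {o : Fin m} (ho : o ∈ S) {z : Fin n → Bool} (hzσ : z σ = false) (hz : InSliceBut I y K e w₁ z) (b : Bool) :
    InSliceBut I y K e w₁ (Function.update z (q o) b) := by
  have hσq := sigma_ne_q H ho
  refine ⟨fun j hj hje => ?_, ?_⟩
  · by_cases hjo : j = o
    · subst hjo
      rw [← hz.1 j hj hje, eval_sib H ho, eval_sib H ho, Function.update_of_ne hσq, hzσ, Bool.false_and, Bool.false_and,
        Function.update_of_ne ((H.hX j hj).2.2.2.2 j ho).1, Function.update_of_ne ((H.hX j hj).2.2.2.2 j ho).2]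
    · rw [eval_update_of_not_mem I j z (not_mem_varSet ((H.hX j hj).2.2.2.2 o ho).1 ((H.hX j hj).2.2.2.2 o ho).2
        (H.hqpriv o ho j (mem_union_left _ hj) hjo)) b]
      exact hz.1 j hj hje
  · apply bit_injective
    rw [bit_gval_update I H.pure, if_neg (H.hC₁.2.2 o ho), zero_add, hz.2, starSum_q_eq_zero H ho hzσ, mul_zero, add_zero]

/-- With `x_σ = 0` before and after, updating any variable off the XOR slots of `e` keeps `e`'s value. -/
theorem eval_e_update_of_sigma (H : Setup I K w₁ w₂ e σ p S q) {z : Fin n → Bool} {u : Fin n} (b : Bool) (h0 : I.vars e 0 ≠ u) (h1 : I.vars e 1 ≠ u)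
    (hzσ : z σ = false) (hzσ' : Function.update z u b σ = false) : I.eval (Function.update z u b) e = I.eval z e := by
  rw [eval_e H, eval_e H, Function.update_of_ne h0, Function.update_of_ne h1, hzσ, hzσ', Bool.false_and, Bool.false_and]

/-- With `x_σ = 0`, updating a sibling private `q o` keeps `A` (and `A₁`). -/
theorem inSlice_update_q (H : Setup I K w₁ w₂ e σ p S q) {o : Fin m} (ho : o ∈ S) {z : Fin n → Bool} (hzσ : z σ = false) (hz : InSlice I y K w₁ z) (b : Bool) :
    InSlice I y K w₁ (Function.update z (q o) b) := by
  have hzb := (inSlice_iff H.he).1 hz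
  refine (inSlice_iff H.he).2 ⟨sliceBut_update_q H ho hzσ hzb.1 b, ?_⟩
  rw [eval_e_update_of_sigma H b ((H.hX e H.he).2.2.2.2 o ho).1 ((H.hX e H.he).2.2.2.2 o ho).2 hzσ
    (by rw [Function.update_of_ne (sigma_ne_q H ho)]; exact hzσ)]
  exact hzb.2

/-- With `x_σ = 0`, updating `p` keeps `A` (and `A₁`). -/
theorem inSlice_update_p (H : Setup I K w₁ w₂ e σ p S q) {z : Fin n → Bool} (hzσ : z σ = false) (hz : InSlice I y K w₁ z) (b : Bool) :
    InSlice I y K w₁ (Function.update z p b) := by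
  have hzb := (inSlice_iff H.he).1 hz
  refine (inSlice_iff H.he).2 ⟨sliceBut_update_p H hzb.1 b, ?_⟩
  rw [eval_e_update_of_sigma H b (H.hX e H.he).2.2.1 (H.hX e H.he).2.2.2.1 hzσ (by rw [Function.update_of_ne (sigma_ne_p H)]; exact hzσ)]
  exact hzb.2

/-- With `x_σ = 0`, normalising any part of `{p} ∪ q(S)` to `0` keeps `A` (and `A₁`). -/
theorem inSlice_clamp (H : Setup I K w₁ w₂ e σ p S q) {T : Finset (Fin n)} (hT : T ⊆ insert p (S.image q)) {z : Fin n → Bool} (hzσ : z σ = false)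
    (hz : InSlice I y K w₁ z) : InSlice I y K w₁ (clamp T z) := by
  induction T using Finset.induction_on with
  | empty => rw [clamp_empty]; exact hz
  | insert a T ha ih =>
    rw [clamp_insert]
    have hT' : T ⊆ insert p (S.image q) := fun w hw => hT (mem_insert_of_mem hw)
    have hσ' : clamp T z σ = false := clamp_false_of hzσ
    rcases mem_insert.1 (hT (mem_insert_self a T)) with rfl | haq
    · exact inSlice_update_p H hσ' (ih hT') false
    · obtain ⟨o, ho, rfl⟩ := mem_image.1 haq
      exact inSlice_update_q H ho hσ' (ih hT') false

/-- With every `x_{q o} = 0`, the partner sum of `σ` over `G₁` vanishes (the outputs of `G₁` through `σ` are siblings). -/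
theorem starSum_sigma_eq_zero (H : Setup I K w₁ w₂ e σ p S q) {z : Fin n → Bool} (hzq : ∀ o ∈ S, z (q o) = false) : starSum I w₁.2.1 σ z = 0 := by
  have heG : e ∉ w₁.2.1 := fun h => disjoint_left.1 H.hKG H.he h
  have hsib : ∀ g ∈ w₁.2.1, Through I σ g → g ∈ S := fun g hg hth => by
    rcases H.hσonly g (mem_union_right _ hg) hth with h | h
    · exact absurd (h ▸ hg) heG
    · exact h
  refine starSum_eq_zero_of_partners z fun g hg => ⟨fun h2 => ?_, fun h3 => ?_⟩
  · have hgS := hsib g hg (Or.inl h2)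
    rcases H.hso g hgS with ⟨_, b⟩ | ⟨a, _⟩
    · rw [b]; exact hzq g hgS
    · exact absurd (a.symm.trans h2) (sigma_ne_q H hgS).symm
  · have hgS := hsib g hg (Or.inr h3)
    rcases H.hso g hgS with ⟨_, b⟩ | ⟨a, _⟩
    · exact absurd (b.symm.trans h3) (sigma_ne_q H hgS).symm
    · rw [a]; exact hzq g hgS

/-- With every sibling private at `0`, updating `σ` keeps every output of `K` other than `e`, and the reader `Γ₁`. -/
theorem sliceBut_update_sigma (H : Setup I K w₁ w₂ e σ p S q) {z : Fin n → Bool} (hzq : ∀ o ∈ S, z (q o) = false) (hz : InSliceBut I y K e w₁ z) (b : Bool) :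
    InSliceBut I y K e w₁ (Function.update z σ b) := by
  refine ⟨fun j hj hje => ?_, ?_⟩
  · by_cases hjS : j ∈ S
    · rw [← hz.1 j hj hje, eval_sib H hjS, eval_sib H hjS, Function.update_of_ne (sigma_ne_q H hjS).symm, hzq j hjS, Bool.and_false,
        Bool.and_false, Function.update_of_ne (H.hX j hj).1, Function.update_of_ne (H.hX j hj).2.1]
    · have hth : ¬ Through I σ j := fun h => by
        rcases H.hσonly j (mem_union_left _ hj) h with h' | h'
        exacts [hje h', hjS h']
      rw [eval_update_of_not_mem I j z (not_mem_varSet (H.hX j hj).1 (H.hX j hj).2.1 hth) b]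
      exact hz.1 j hj hje
  · apply bit_injective
    rw [bit_gval_update I H.pure, if_neg H.hC₁.1, zero_add, hz.2, starSum_sigma_eq_zero H hzq, mul_zero, add_zero]

/-! ### The slopes vanish at idle points -/

/-- (T3) at two points of `A` differing in one variable `v`: the slope `L_v` vanishes. -/
theorem slope_zero_of_pair (H : Setup I K w₁ w₂ e σ p S q) (hT3 : ∀ z, InSlice I y K w₁ z → gval I w₂.1 w₂.2.1 z ≠ w₂.2.2) {z : Fin n → Bool} {v : Fin n}
    (hz : InSlice I y K w₁ z) (hz' : InSlice I y K w₁ (Function.update z v (!z v))) :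
    (if v ∈ w₂.1 then (1 : ZMod 2) else 0) + starSum I w₂.2.1 v z = 0 := by
  have h1 := hT3 z hz
  have h2 := hT3 _ hz'
  have heq : gval I w₂.1 w₂.2.1 (Function.update z v (!z v)) = gval I w₂.1 w₂.2.1 z := by
    revert h1 h2
    cases gval I w₂.1 w₂.2.1 (Function.update z v (!z v)) <;> cases gval I w₂.1 w₂.2.1 z <;> cases w₂.2.2 <;> decide
  have hflip := bit_gval_flip I H.pure w₂.1 w₂.2.1 z v
  rw [heq] at hflip
  linear_combination -hflip

/-- `L_p ≡ 0` on `A₁`. -/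
theorem slope_p_zero (H : Setup I K w₁ w₂ e σ p S q) (hT3 : ∀ z, InSlice I y K w₁ z → gval I w₂.1 w₂.2.1 z ≠ w₂.2.2) {z : Fin n → Bool} (hz : InSlice I y K w₁ z)
    (hzσ : z σ = false) : (if p ∈ w₂.1 then (1 : ZMod 2) else 0) + starSum I w₂.2.1 p z = 0 :=
  slope_zero_of_pair H hT3 hz (inSlice_update_p H hzσ hz _)

/-- `L_{q o} ≡ 0` on `A₁`, for every sibling `o`. -/
theorem slope_q_zero (H : Setup I K w₁ w₂ e σ p S q) (hT3 : ∀ z, InSlice I y K w₁ z → gval I w₂.1 w₂.2.1 z ≠ w₂.2.2) {o : Fin m} (ho : o ∈ S) {z : Fin n → Bool}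
    (hz : InSlice I y K w₁ z) (hzσ : z σ = false) : (if q o ∈ w₂.1 then (1 : ZMod 2) else 0) + starSum I w₂.2.1 (q o) z = 0 :=
  slope_zero_of_pair H hT3 hz (inSlice_update_q H ho hzσ hz _)

/-- `L_σ = 0` at points of `A` with `x_p = 0` and every `x_{q o} = 0`. -/
theorem slope_sigma_zero (H : Setup I K w₁ w₂ e σ p S q) (hT3 : ∀ z, InSlice I y K w₁ z → gval I w₂.1 w₂.2.1 z ≠ w₂.2.2) {z : Fin n → Bool} (hz : InSlice I y K w₁ z)
    (hzp : z p = false) (hzq : ∀ o ∈ S, z (q o) = false) : (if σ ∈ w₂.1 then (1 : ZMod 2) else 0) + starSum I w₂.2.1 σ z = 0 := by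
  have hzb := (inSlice_iff H.he).1 hz
  refine slope_zero_of_pair H hT3 hz ((inSlice_iff H.he).2 ⟨sliceBut_update_sigma H hzq hzb.1 _, ?_⟩)
  have := hzb.2
  rw [eval_e H] at this ⊢
  rw [Function.update_of_ne (H.hX e H.he).1, Function.update_of_ne (H.hX e H.he).2.1, Function.update_of_ne (sigma_ne_p H).symm, hzp,
    Bool.and_false]
  rw [hzp, Bool.and_false] at this
  exact this

/-! ### Gate partners are never thawed in `A₁` -/

/-- A gate partner `u ≠ σ` of `p` is not thawed in `A₁`. -/
theorem not_thawed_p (H : Setup I K w₁ w₂ e σ p S q) (hT3 : ∀ z, InSlice I y K w₁ z → gval I w₂.1 w₂.2.1 z ≠ w₂.2.2) {g : Fin m} (hg : g ∈ w₂.2.1) {u : Fin n}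
    (hgs : (I.vars g 2 = p ∧ I.vars g 3 = u) ∨ (I.vars g 2 = u ∧ I.vars g 3 = p))
    (huniq : ∀ g' ∈ w₂.2.1, g' ≠ g → ¬ ((I.vars g' 2 = p ∧ I.vars g' 3 = u) ∨ (I.vars g' 2 = u ∧ I.vars g' 3 = p)))
    (huσ : u ≠ σ) {z : Fin n → Bool} (hz : InSlice I y K w₁ z) (hzσ : z σ = false) (hz' : InSlice I y K w₁ (Function.update z u (!z u))) :
    False := by
  have hzσ' : Function.update z u (!z u) σ = false := by rw [Function.update_of_ne huσ.symm]; exact hzσ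
  have h0 := slope_p_zero H hT3 hz hzσ
  have h1 := slope_p_zero H hT3 hz' hzσ'
  have hmove := starSum_update_partner I H.pure hg hgs huniq z (!z u)
  have hba : bit (!z u) + bit (z u) = 1 := by cases z u <;> decide
  rw [hmove, hba] at h1
  have h2 : (1 : ZMod 2) = 0 := by linear_combination h1 - h0
  exact absurd h2 (by decide)

/-- A gate partner `u ≠ σ` of a sibling private `q o` is not thawed in `A₁`. -/
theorem not_thawed_q (H : Setup I K w₁ w₂ e σ p S q) (hT3 : ∀ z, InSlice I y K w₁ z → gval I w₂.1 w₂.2.1 z ≠ w₂.2.2) {o : Fin m} (ho : o ∈ S) {g : Fin m}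
    (hg : g ∈ w₂.2.1) {u : Fin n} (hgs : (I.vars g 2 = q o ∧ I.vars g 3 = u) ∨ (I.vars g 2 = u ∧ I.vars g 3 = q o))
    (huniq : ∀ g' ∈ w₂.2.1, g' ≠ g → ¬ ((I.vars g' 2 = q o ∧ I.vars g' 3 = u) ∨ (I.vars g' 2 = u ∧ I.vars g' 3 = q o)))
    (huσ : u ≠ σ) {z : Fin n → Bool} (hz : InSlice I y K w₁ z) (hzσ : z σ = false) (hz' : InSlice I y K w₁ (Function.update z u (!z u))) :
    False := by
  have hzσ' : Function.update z u (!z u) σ = false := by rw [Function.update_of_ne huσ.symm]; exact hzσ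
  have h0 := slope_q_zero H hT3 ho hz hzσ
  have h1 := slope_q_zero H hT3 ho hz' hzσ'
  have hmove := starSum_update_partner I H.pure hg hgs huniq z (!z u)
  have hba : bit (!z u) + bit (z u) = 1 := by cases z u <;> decide
  rw [hmove, hba] at h1
  have h2 : (1 : ZMod 2) = 0 := by linear_combination h1 - h0
  exact absurd h2 (by decide)

/-- A gate partner `u` of `σ` off the block (`u ≠ σ, p` and `u ≠ q o` for every sibling) is not thawed in `A₁` (normalise `x_p = x_{q o} = 0`
first, at both points at once, by `clamp`). -/
theorem not_thawed_sigma (H : Setup I K w₁ w₂ e σ p S q) (hT3 : ∀ z, InSlice I y K w₁ z → gval I w₂.1 w₂.2.1 z ≠ w₂.2.2) {g : Fin m} (hg : g ∈ w₂.2.1) {u : Fin n}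
    (hgs : (I.vars g 2 = σ ∧ I.vars g 3 = u) ∨ (I.vars g 2 = u ∧ I.vars g 3 = σ))
    (huniq : ∀ g' ∈ w₂.2.1, g' ≠ g → ¬ ((I.vars g' 2 = σ ∧ I.vars g' 3 = u) ∨ (I.vars g' 2 = u ∧ I.vars g' 3 = σ)))
    (hup : u ≠ p) (huq : ∀ o ∈ S, u ≠ q o) (huσ : u ≠ σ) {z : Fin n → Bool} (hz : InSlice I y K w₁ z) (hzσ : z σ = false)
    (hz' : InSlice I y K w₁ (Function.update z u (!z u))) : False := by
  set N := insert p (S.image q) with hN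
  have huN : u ∉ N := fun h => by
    rcases mem_insert.1 h with h | h
    · exact hup h
    · obtain ⟨o, ho, hoq⟩ := mem_image.1 h
      exact huq o ho hoq.symm
  have hzσ' : Function.update z u (!z u) σ = false := by rw [Function.update_of_ne huσ.symm]; exact hzσ
  set z₀ := clamp N z with hz₀
  have hz₀A : InSlice I y K w₁ z₀ := inSlice_clamp H subset_rfl hzσ hz
  have hz₀u : z₀ u = z u := clamp_of_not_mem huN z
  have hz₀' : Function.update z₀ u (!z₀ u) = clamp N (Function.update z u (!z u)) := by
    rw [clamp_update_comm huN, hz₀u]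
  have hz₀'A : InSlice I y K w₁ (Function.update z₀ u (!z₀ u)) := by
    rw [hz₀']
    exact inSlice_clamp H subset_rfl hzσ' hz'
  have hp0 : z₀ p = false := clamp_of_mem (mem_insert_self _ _) z
  have hq0 : ∀ o ∈ S, z₀ (q o) = false := fun o ho => clamp_of_mem (mem_insert_of_mem (mem_image_of_mem q ho)) z
  have hp0' : Function.update z₀ u (!z₀ u) p = false := by rw [Function.update_of_ne hup.symm]; exact hp0
  have hq0' : ∀ o ∈ S, Function.update z₀ u (!z₀ u) (q o) = false := fun o ho => by
    rw [Function.update_of_ne (huq o ho).symm]; exact hq0 o ho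
  have h0 := slope_sigma_zero H hT3 hz₀A hp0 hq0
  have h1 := slope_sigma_zero H hT3 hz₀'A hp0' hq0'
  have hmove := starSum_update_partner I H.pure hg hgs huniq z₀ (!z₀ u)
  have hba : bit (!z₀ u) + bit (z₀ u) = 1 := by cases z₀ u <;> decide
  rw [hmove, hba] at h1
  have h2 : (1 : ZMod 2) = 0 := by linear_combination h1 - h0
  exact absurd h2 (by decide)

end Main

end Summit.PneNP.PneNP.Theorems.PstarMultiSiblingSquare
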